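import Summits.MatrixMultiplication.MatrixMultiplication.Theorems.SoloInformedBoxEnding

/-!
# From line data to a heavy box: the two extraction steps of THEOREM 8.20, with the numerical ending

This work, §8.8 (T13) and C3-m2 §5.5–5.6 (gen 108: the kernel glue). Setting as in `SoloInformedBoxEnding`.

Step 2 of THEOREM 8.20 delivers LINE DATA over a heavy index set `𝓛` (column `j` of `a` is `∼ v′` off `≤ d`
rows, row `j` of `b` is `∼ v` off `≤ d` columns); Step 3.1 delivers `a ∼ α` on `I₁ × J_p` off `≤ d` cells per
row and per column and `b(·,k) ∼ β` on `J_p` off `≤ d` rows for `k ∈ K_g` (column-wise only). In both shapes the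
uncontrolled transversal lines are discarded by double counting (`heavy_card_mul_le`: the lines meeting `> d′`
exception sets number at most `|family|·d/(d′+1)`; with `d′ = 2c·d` at least half of a `c`-heavy side survives,
`BoxArith.heavy_half`), which yields exactly the four hypotheses of `Data.box_ending` with `e = d + d′`
(`Data.lines_to_box`, `Data.cols_to_box`). `Data.lines_ending` / `Data.cols_ending` are the resulting numerical
endings `n³ ≤ C·(r·|S⁰|)` — every class configuration, explicit constants.
-/

namespace Summit.MatrixMultiplication.MatrixMultiplication.Theorems.TwistedTPP

namespace FibreLines

/-- Double counting: the lines of `T` meeting more than `d′` of the exception sets `X j` (`j ∈ L`, `|X j| ≤ d`)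
number `H` with `H·(d′+1) ≤ |L|·d`. -/
theorem heavy_card_mul_le {ι : Type*} [DecidableEq ι] (L T : Finset ι) (X : ι → Finset ι) (d d' : ℕ)
    (hX : ∀ j ∈ L, (X j).card ≤ d) :
    (T.filter fun i => ¬ (L.filter fun j => i ∈ X j).card ≤ d').card * (d' + 1) ≤ L.card * d := by
  set H : Finset ι := T.filter fun i => ¬ (L.filter fun j => i ∈ X j).card ≤ d' with hH
  have hcount : H.card • (d' + 1) ≤ L.card • d := by
    refine Finset.card_nsmul_le_card_nsmul (r := fun i j => i ∈ X j) ?_ ?_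
    · intro i hi
      have h1 : ¬ (L.filter fun j => i ∈ X j).card ≤ d' := (Finset.mem_filter.1 hi).2
      have h2 : (L.filter fun j => i ∈ X j) = L.bipartiteAbove (fun i j => i ∈ X j) i := rfl
      exact le_trans (by omega) (le_of_eq (congrArg Finset.card h2))
    · intro j hj
      have hsub : H.bipartiteBelow (fun i j => i ∈ X j) j ⊆ X j := by
        intro i hi
        rw [Finset.mem_bipartiteBelow] at hi
        exact hi.2
      exact (Finset.card_le_card hsub).trans (hX j hj)
  rwa [smul_eq_mul, smul_eq_mul] at hcount

namespace BoxArith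

/-- If the heavy lines `H` of a `c_J`-heavy side `J_p = L ⊔ H` satisfy `H·(d′+1) ≤ |K_g|·d` with `d′ ≥ 2c_J d`,
then the light part is `2c_J`-heavy. -/
theorem heavy_half (H L Jp Kg n cJ d d' : ℕ) (hH : H * (d' + 1) ≤ Kg * d) (hd : 2 * cJ * d ≤ d')
    (hKg : Kg ≤ n) (hJ : n ≤ cJ * Jp) (hsplit : L + H = Jp) : n ≤ 2 * cJ * L := by
  have h1 : H * (2 * cJ * d + 1) ≤ cJ * Jp * d := by
    calc H * (2 * cJ * d + 1) ≤ H * (d' + 1) := Nat.mul_le_mul_left _ (by omega)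
      _ ≤ Kg * d := hH
      _ ≤ n * d := Nat.mul_le_mul_right _ hKg
      _ ≤ cJ * Jp * d := Nat.mul_le_mul_right _ hJ
  have h4 : 2 * H ≤ Jp := by
    by_contra hc
    push Not at hc
    have h5 := Nat.mul_le_mul_right (2 * cJ * d + 1) (show Jp + 1 ≤ 2 * H by omega)
    nlinarith [h5, h1]
  subst hsplit
  have h6 := Nat.mul_le_mul_left cJ (show H ≤ L by omega)
  nlinarith [h6, hJ]

end BoxArith

variable {ι G : Type*} [AddCommGroup G]

/-- **Lines to box.** Line data over `𝓛` (`a(·,j) ∼ v′` off `Ea j`, `b(j,·) ∼ v` off `Fb j`, sizes `≤ d`)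
give light sets `I₀, K₀` of at least half the rows / columns on which the box `I₀ × 𝓛 × K₀` carries the four
hypotheses of `Data.box_ending` with `e = 3d`. [C3-m2 §5.5] -/
theorem Data.lines_to_box [Fintype ι] [DecidableEq ι] (D : Data ι G) {v v' : G} (L : Finset ι) (d : ℕ)
    (Ea Fb : ι → Finset ι) (hEa : ∀ j ∈ L, (Ea j).card ≤ d ∧ ∀ i, i ∉ Ea j → SignEq (D.a i j) v')
    (hFb : ∀ j ∈ L, (Fb j).card ≤ d ∧ ∀ k, k ∉ Fb j → SignEq (D.b j k) v) :
    ∃ I₀ K₀ : Finset ι, Fintype.card ι ≤ 2 * I₀.card ∧ Fintype.card ι ≤ 2 * K₀.card ∧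
      (∀ j ∈ L, ∃ E : Finset ι, E.card ≤ 3 * d ∧ ∀ i ∈ I₀, i ∉ E → SignEq (D.a i j) v') ∧
      (∀ i ∈ I₀, ∃ E : Finset ι, E.card ≤ 3 * d ∧ ∀ j ∈ L, j ∉ E → SignEq (D.a i j) v') ∧
      (∀ j ∈ L, ∃ E : Finset ι, E.card ≤ 3 * d ∧ ∀ k ∈ K₀, k ∉ E → SignEq (D.b j k) v) ∧
      (∀ k ∈ K₀, ∃ E : Finset ι, E.card ≤ 3 * d ∧ ∀ j ∈ L, j ∉ E → SignEq (D.b j k) v) := by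
  classical
  set I₀ : Finset ι := Finset.univ.filter fun i => (L.filter fun j => i ∈ Ea j).card ≤ 2 * d with hI₀
  set K₀ : Finset ι := Finset.univ.filter fun k => (L.filter fun j => k ∈ Fb j).card ≤ 2 * d with hK₀
  have half : ∀ X : ι → Finset ι, (∀ j ∈ L, (X j).card ≤ d) →
      Fintype.card ι ≤ 2 * (Finset.univ.filter fun i => (L.filter fun j => i ∈ X j).card ≤ 2 * d).card := by
    intro X hX
    have hsplit : (Finset.univ.filter fun i => (L.filter fun j => i ∈ X j).card ≤ 2 * d).card +
        (Finset.univ.filter fun i => ¬ (L.filter fun j => i ∈ X j).card ≤ 2 * d).card = Fintype.card ι := by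
      rw [← Finset.card_univ]; exact Finset.card_filter_add_card_filter_not _
    have h := BoxArith.heavy_half _ _ (Fintype.card ι) L.card (Fintype.card ι) 1 d (2 * d)
      (heavy_card_mul_le L Finset.univ X d (2 * d) hX) (by omega) (Finset.card_le_univ _) (by omega) hsplit
    omega
  refine ⟨I₀, K₀, half Ea fun j hj => (hEa j hj).1, half Fb fun j hj => (hFb j hj).1, ?_, ?_, ?_, ?_⟩
  · exact fun j hj => ⟨Ea j, by have := (hEa j hj).1; omega, fun i _ hi => (hEa j hj).2 i hi⟩
  · intro i hi
    refine ⟨L.filter fun j => i ∈ Ea j, by have := (Finset.mem_filter.1 hi).2; omega, fun j hj hjE => ?_⟩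
    exact (hEa j hj).2 i fun h => hjE (Finset.mem_filter.2 ⟨hj, h⟩)
  · exact fun j hj => ⟨Fb j, by have := (hFb j hj).1; omega, fun k _ hk => (hFb j hj).2 k hk⟩
  · intro k hk
    refine ⟨L.filter fun j => k ∈ Fb j, by have := (Finset.mem_filter.1 hk).2; omega, fun j hj hjE => ?_⟩
    exact (hFb j hj).2 k fun h => hjE (Finset.mem_filter.2 ⟨hj, h⟩)

/-- **Columns to box.** `a ∼ α` on `I₁ × J_p` off `≤ d` cells per row (`Ea i`) and per column (`Ec j`),
`b(·,k) ∼ β` on `J_p` off `≤ d` rows (`Fb k`) for `k ∈ K_g`, and `n ≤ c_J|J_p|`: the light rows `L ⊆ J_p` are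
`2c_J`-heavy and the box `I₁ × L × K_g` carries the four hypotheses of `Data.box_ending` with
`e = (2c_J+1)d`. [C3-m2 §5.5–5.6 (B)] -/
theorem Data.cols_to_box [Fintype ι] [DecidableEq ι] (D : Data ι G) {α β : G} (I₁ Jp Kg : Finset ι)
    (d cJ : ℕ) (Ea Ec Fb : ι → Finset ι)
    (hEa : ∀ i ∈ I₁, (Ea i).card ≤ d ∧ ∀ j ∈ Jp, j ∉ Ea i → SignEq (D.a i j) α)
    (hEc : ∀ j ∈ Jp, (Ec j).card ≤ d ∧ ∀ i ∈ I₁, i ∉ Ec j → SignEq (D.a i j) α)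
    (hFb : ∀ k ∈ Kg, (Fb k).card ≤ d ∧ ∀ j ∈ Jp, j ∉ Fb k → SignEq (D.b j k) β)
    (hJ : Fintype.card ι ≤ cJ * Jp.card) :
    ∃ L ⊆ Jp, Fintype.card ι ≤ 2 * cJ * L.card ∧
      (∀ j ∈ L, ∃ E : Finset ι, E.card ≤ (2 * cJ + 1) * d ∧ ∀ i ∈ I₁, i ∉ E → SignEq (D.a i j) α) ∧
      (∀ i ∈ I₁, ∃ E : Finset ι, E.card ≤ (2 * cJ + 1) * d ∧ ∀ j ∈ L, j ∉ E → SignEq (D.a i j) α) ∧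
      (∀ j ∈ L, ∃ E : Finset ι, E.card ≤ (2 * cJ + 1) * d ∧ ∀ k ∈ Kg, k ∉ E → SignEq (D.b j k) β) ∧
      (∀ k ∈ Kg, ∃ E : Finset ι, E.card ≤ (2 * cJ + 1) * d ∧ ∀ j ∈ L, j ∉ E → SignEq (D.b j k) β) := by
  classical
  set L : Finset ι := Jp.filter fun j => (Kg.filter fun k => j ∈ Fb k).card ≤ 2 * cJ * d with hLdef
  have hsplit : L.card + (Jp.filter fun j => ¬ (Kg.filter fun k => j ∈ Fb k).card ≤ 2 * cJ * d).card =
      Jp.card := Finset.card_filter_add_card_filter_not _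
  have hL : Fintype.card ι ≤ 2 * cJ * L.card :=
    BoxArith.heavy_half _ _ Jp.card Kg.card (Fintype.card ι) cJ d (2 * cJ * d)
      (heavy_card_mul_le Kg Jp Fb d (2 * cJ * d) fun k hk => (hFb k hk).1) le_rfl (Finset.card_le_univ _)
      hJ hsplit
  have hLJ : ∀ j ∈ L, j ∈ Jp := fun j hj => (Finset.mem_filter.1 hj).1
  have hd : d ≤ (2 * cJ + 1) * d := by nlinarith
  have hd' : 2 * cJ * d ≤ (2 * cJ + 1) * d := by nlinarith
  refine ⟨L, Finset.filter_subset _ _, hL, ?_, ?_, ?_, ?_⟩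
  · exact fun j hj => ⟨Ec j, (hEc j (hLJ j hj)).1.trans hd, fun i hi hiE => (hEc j (hLJ j hj)).2 i hi hiE⟩
  · exact fun i hi => ⟨Ea i, (hEa i hi).1.trans hd, fun j hj hjE => (hEa i hi).2 j (hLJ j hj) hjE⟩
  · intro j hj
    refine ⟨Kg.filter fun k => j ∈ Fb k, le_trans (Finset.mem_filter.1 hj).2 hd', fun k hk hkE => ?_⟩
    exact (hFb k hk).2 j (hLJ j hj) fun h => hkE (Finset.mem_filter.2 ⟨hk, h⟩)
  · exact fun k hk => ⟨Fb k, (hFb k hk).1.trans hd, fun j hj hjE => (hFb k hk).2 j (hLJ j hj) hjE⟩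

variable {G₀ : Type*} [AddCommGroup G₀] {R : Type*}

/-- **Numerical ending of Step 2 of THEOREM 8.20 (line data over a `c_L`-heavy `𝓛`).**
`144·c_L·(3d+1) ≤ n` gives `n³ ≤ 48·c_L·(r·|S⁰|)`, whatever the classes `v, v′`. [C3-m2 §5.5–5.6] -/
theorem Data.lines_ending [Fintype ι] [DecidableEq ι] [Fintype G₀] [DecidableEq G₀] [Fintype R]
    [DecidableEq R] [DecidableEq G] (hG : ∀ x : G, x = -x → x = 0) (D : Data ι G) (Φ : Chart ι G₀)
    (κ : G → R) (hκ : ∀ x y, κ x = κ y → SignEq x y) (hsep : D.SepAll Φ) {v v' : G} (L : Finset ι)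
    (d cL : ℕ) (Ea Fb : ι → Finset ι)
    (hEa : ∀ j ∈ L, (Ea j).card ≤ d ∧ ∀ i, i ∉ Ea j → SignEq (D.a i j) v')
    (hFb : ∀ j ∈ L, (Fb j).card ≤ d ∧ ∀ k, k ∉ Fb j → SignEq (D.b j k) v)
    (hL : Fintype.card ι ≤ cL * L.card) (he : 144 * cL * (3 * d + 1) ≤ Fintype.card ι) :
    Fintype.card ι ^ 3 ≤ 48 * cL * (Fintype.card R * Fintype.card G₀) := by
  obtain ⟨I₀, K₀, hI, hK, hac, har, hbr, hbc⟩ := D.lines_to_box L d Ea Fb hEa hFb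
  have h := D.box_ending hG Φ κ hκ hsep I₀ L K₀ (3 * d) 2 cL 2 hac har hbr hbc (by omega) hL (by omega)
    (by
      calc 36 * (2 * cL * 2) * (3 * d + 1) = 144 * cL * (3 * d + 1) := by ring
        _ ≤ Fintype.card ι := he)
  calc Fintype.card ι ^ 3 ≤ 12 * (2 * cL * 2) * (Fintype.card R * Fintype.card G₀) := h
    _ = 48 * cL * (Fintype.card R * Fintype.card G₀) := by ring

/-- **Numerical ending of Step 3.1 of THEOREM 8.20 (the Step-3.1 shape with heavy sides).**
`36·c_I·2c_J·c_K·((2c_J+1)d+1) ≤ n` gives `n³ ≤ 12·c_I·2c_J·c_K·(r·|S⁰|)`, whatever the classes `α, β`.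
[C3-m2 §5.5–5.6 (B)] -/
theorem Data.cols_ending [Fintype ι] [DecidableEq ι] [Fintype G₀] [DecidableEq G₀] [Fintype R]
    [DecidableEq R] [DecidableEq G] (hG : ∀ x : G, x = -x → x = 0) (D : Data ι G) (Φ : Chart ι G₀)
    (κ : G → R) (hκ : ∀ x y, κ x = κ y → SignEq x y) (hsep : D.SepAll Φ) {α β : G}
    (I₁ Jp Kg : Finset ι) (d cI cJ cK : ℕ) (Ea Ec Fb : ι → Finset ι)
    (hEa : ∀ i ∈ I₁, (Ea i).card ≤ d ∧ ∀ j ∈ Jp, j ∉ Ea i → SignEq (D.a i j) α)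
    (hEc : ∀ j ∈ Jp, (Ec j).card ≤ d ∧ ∀ i ∈ I₁, i ∉ Ec j → SignEq (D.a i j) α)
    (hFb : ∀ k ∈ Kg, (Fb k).card ≤ d ∧ ∀ j ∈ Jp, j ∉ Fb k → SignEq (D.b j k) β)
    (hI : Fintype.card ι ≤ cI * I₁.card) (hJ : Fintype.card ι ≤ cJ * Jp.card)
    (hK : Fintype.card ι ≤ cK * Kg.card)
    (he : 36 * (cI * (2 * cJ) * cK) * ((2 * cJ + 1) * d + 1) ≤ Fintype.card ι) :
    Fintype.card ι ^ 3 ≤ 12 * (cI * (2 * cJ) * cK) * (Fintype.card R * Fintype.card G₀) := by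
  obtain ⟨L, -, hL, hac, har, hbr, hbc⟩ := D.cols_to_box I₁ Jp Kg d cJ Ea Ec Fb hEa hEc hFb hJ
  exact D.box_ending hG Φ κ hκ hsep I₁ L Kg ((2 * cJ + 1) * d) cI (2 * cJ) cK hac har hbr hbc hI hL hK he

end FibreLines

end Summit.MatrixMultiplication.MatrixMultiplication.Theorems.TwistedTPP
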